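import Summits.QuantumFields.YangMills.Theorems.F4SubCurvatureDoorSubCurvatureClauseMixedAxisDomination
import Summits.QuantumFields.YangMills.Theorems.ForcedResponseSkewnessRunningCouplingCeilingDefs
import HarnessLib

/-!
# Route `ForcedResponseSkewness`, crux `RunningCouplingCeiling` ⟨stmt-QuantumFields-24275⟩ — AXIS DOMINATION of the PLAIN torus
# covariance of Wilson's action density by BOTH reflection orders of the on-axis coupling

Helper file (`--supports stmt-QuantumFields-24275`; free-hands seat `ym-line-frs-p2` g20).  Definition-free, 0 sorry, standard axioms.
No item is closed; no summit, no crux and no mass gap is proved by this file.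

WHY.  The symmetrised skeleton letters of the crux idea «rp-moebius-ladder» (ym-idea-3 g24–g26; ⟨stmt-QuantumFields-23763⟩ alt skeleton
`129694558f839039`, and g26's export line toward ⟨24275⟩) carry the dimensionless on-axis couplings
`G(t) = (2t)⁸·lCC(Q^θ,Q,2t)` and `G'(t) = (2t)⁸·lCC(Q,Q^θ,2t)` (`lCC = latticeConnectedCorr r.ρ β (2L+1)`, `Q = r.curvature.F`,
`Q^θ = r.curvature.timeReflect.F`).  The kernel of the crux's smeared two-point function `Q2` is the PLAIN torus covariance
`torusCov G r β L x y = Cov_T(dens x, dens y)` (`Q2_eq_sum_torusCov`).  This file proves the reflection-positivity domination of that plain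
kernel by the two axis orders, in the `torusE / dens / torusCov` letters of the route (the tree's ✓`CurvatureKernel.AxisDominationOfForm`
states the same inequality in lifted-integral letters, but its module is not served by the build farm; the argument is re-run here over
the served ✓`CurvatureKernel.OddTorusCovCauchySchwarz` and the g19 mixed-kernel toolkit ✓`…MixedAxisDomination`):

* `lcc'_eq_mixedKernel_neg` (§2): the MIRROR order on the axis is the mixed kernel at NEGATIVE times,
  `lCC(Q,Q^θ,n) = Cov_T(dens 0 ∘ Θ₀, dens (−n e₀))`;
* `torusCov_translate`, `torusCov_comm` (§3): `torusCov x y` depends on `y − x` only and is symmetric;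
* ★ `sq_torusCov_le_lcc_mul_lcc` (§4): for `β ≥ 0`, `t + 2 ≤ L`, `2 ≤ t'`, `t' + 1 ≤ L` and `y₀ − x₀ = t + t'`:
  `torusCov(x,y)² ≤ lCC(Q,Q^θ,2t') · lCC(Q^θ,Q,2t)`, both factors `≥ 0` (Gram pair: the reflected density at height `t'` and the
  density at height `t`; reflection plane between them);
* ★ `abs_torusCov_le_of_axis_bounds` (§5): for a time separation `|y₀ − x₀| = n ≥ 3` with `n/2 + 2 ≤ L` and a common bound `B ≥ 0` on
  `G(⌊n/2⌋)` and `G'(⌈n/2⌉)`: `|torusCov(x,y)| ≤ B/(n−1)⁸`.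

[cite: OsterwalderSeiler1978, §2]; [cite: FrohlichIsraelLiebSimon1978, Thm. 2.1].

HONEST LABEL: a soft lattice lemma (reflection positivity only); `MoebiusRow` (XL) / `CrossoverDecay` (L–XL) and the cruxes ⟨24275⟩,
⟨23763⟩, ⟨26871⟩ are OPEN; the Yang–Mills mass gap is NOT proved; no summit is proved by a line.
-/

set_option autoImplicit false

noncomputable section

open MeasureTheory Filter Topology
open Literature.MathematicalPhysics.QuantumFieldTheory Literature.MathematicalPhysics.QuantumLattice
open Literature.Probability.LatticeModels (Site)
open Summit.QuantumFields.YangMills.Cruxes.OSLegsFromFemtoAndGap.DlrCollarTransfer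
open Summit.QuantumFields.YangMills.Cruxes.OSLegsFromFemtoAndGap.DlrCollarTransfer.StubLower (exists_abs_dens_le)
open Summit.QuantumFields.YangMills.Theorems.OSLegsFromFemtoAndGap (torusE_dens_eq_wilsonTorusMean)
open Summit.QuantumFields.YangMills.Cruxes.NT.MarkovMirror (dependsOn_strictHalf_of_posHalf dependsOn_posHalf_of_window
  continuous_cfgReflect)
open Summit.QuantumFields.YangMills.Cruxes.NT.ConjugateResponse (torusE_comp_cfgReflect)
open Summit.QuantumFields.YangMills.Cruxes.UniversalDetectorPlaneTight (torusE_configShift_neg dens_configShift_neg)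
open Summit.QuantumFields.YangMills.Theorems.CurvatureKernel (OddTorusCovCauchySchwarz)
open Summit.QuantumFields.YangMills.Theorems.F4SubCurvatureDoorSubCurvatureClauseMixedAxisDomination
  (dens_zero_apply lcc_eq_mixedKernel mixedCov_translate dependsOn_dens_posHalf)
open Summit.QuantumFields.YangMills.Cruxes.RunningCouplingCeiling.Pointwise (torusCov)

namespace Summit.QuantumFields.YangMills.Theorems.ForcedResponseSkewnessRunningCouplingCeilingCovAxisDomination

variable {G : Type} [Group G] [TopologicalSpace G] [IsTopologicalGroup G] [CompactSpace G]
  [MeasurableSpace G] [BorelSpace G]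

/-! ## §1 The reflected density insertion lives in the positive half -/

/-- Time component of the base point of a reflected link. [folklore] -/
theorem reflectEdge_fst_zero (e : Literature.MathematicalPhysics.QuantumLattice.ZdEdge 4) :
    (reflectEdge e).1 0 = if e.2 = 0 then -(e.1 0) - 1 else -(e.1 0) := by
  by_cases h : e.2 = 0
  · rw [if_pos h]
    unfold reflectEdge
    rw [if_pos h]
    simp [siteReflect_apply_zero]
  · rw [if_neg h]
    unfold reflectEdge
    rw [if_neg h]
    simp [siteReflect_apply_zero]

/-- `dens u ∘ Θ₀` is the reflected species translated to `θ₀ u`. [folklore] -/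
theorem dens_cfgReflect_eq (r : LatticeRep G) (u : Site 4) (V : LGConfig 4 G) :
    dens G r u (cfgReflect V) = (r.curvature.timeReflect.F ∘ configShift (-(siteReflect u))) V := by
  simp only [Function.comp_apply, LocalGaugeObservable.timeReflect_F]
  unfold dens
  rw [cfgReflect_configShift, siteReflect_neg, siteReflect_siteReflect]

/-- **A density insertion at a site of time `u₀ ≤ −2` with `−u₀ + 1 ≤ L`, read on the REFLECTED lifted field, is an observable of the
closed non-negative half** of the odd torus `2L+1` (it is the reflected species at `θ₀u`, whose links are based at times
`−u₀ − 2, −u₀ − 1, −u₀`). [folklore] -/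
theorem dependsOn_dens_cfgReflect_posHalf (r : LatticeRep G) (L : ℕ) (u : Site 4) (hu : u 0 ≤ -2 ∧ -(u 0) + 1 ≤ (L : ℤ)) :
    DependsOn (fun U : GaugeConfig 4 (2 * L + 1) G => dens G r u (cfgReflect (torusLift (2 * L + 1) U)))
      {e : Edge 4 (2 * L + 1) | (e.1 0).val ≤ L ∧ ((e.1.shift e.2) 0).val ≤ L} := by
  have hcyl := IsCylinder.comp_configShift r.curvature.timeReflect.isCylinder (-(siteReflect u))
  have hfun : (fun U : GaugeConfig 4 (2 * L + 1) G => dens G r u (cfgReflect (torusLift (2 * L + 1) U))) =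
      fun U => (r.curvature.timeReflect.F ∘ configShift (-(siteReflect u))) (torusLift (2 * L + 1) U) := by
    funext U; exact dens_cfgReflect_eq r u _
  rw [hfun]
  refine dependsOn_posHalf_of_window (G := G) L hcyl fun e he => ?_
  obtain ⟨e₁, he₁, rfl⟩ := Finset.mem_image.1 he
  rw [LocalGaugeObservable.timeReflect_supp] at he₁
  obtain ⟨e₂, he₂, rfl⟩ := Finset.mem_image.1 he₁
  have key := reflectEdge_fst_zero e₂
  -- base times of the curvature support lie in `{0, 1}` (the landed `CurvatureKernel.AxisDom.curvature_supp_time` lives in a module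
  -- whose olean the farm does not serve; inlined)
  have ht : e₂.1 0 = 0 ∨ e₂.1 0 = 1 := by
    have hs : r.curvature.supp = Finset.univ.biUnion fun p : Fin 4 × Fin 4 => originPlaquetteSupport p.1 p.2 := rfl
    rw [hs, Finset.mem_biUnion] at he₂
    obtain ⟨p, -, hp⟩ := he₂
    simp only [originPlaquetteSupport, Finset.mem_insert, Finset.mem_singleton] at hp
    rcases hp with rfl | rfl | rfl | rfl
    · exact Or.inl rfl
    · by_cases h : p.1 = 0
      · exact Or.inr (by simp [h])
      · exact Or.inl (by simp [h])
    · by_cases h : p.2 = 0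
      · exact Or.inr (by simp [h])
      · exact Or.inl (by simp [h])
    · exact Or.inl rfl
  show 0 ≤ ((reflectEdge e₂).1 - -siteReflect u) 0 ∧ ((reflectEdge e₂).1 - -siteReflect u) 0 + 1 ≤ (L : ℤ)
  rw [Pi.sub_apply, Pi.neg_apply, siteReflect_apply_zero, key]
  obtain ⟨hu1, hu2⟩ := hu
  by_cases h2 : e₂.2 = 0
  · rw [if_pos h2]
    rcases ht with h0 | h1
    · rw [h0]; constructor <;> omega
    · rw [h1]; constructor <;> omega
  · rw [if_neg h2]
    rcases ht with h0 | h1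
    · rw [h0]; constructor <;> omega
    · rw [h1]; constructor <;> omega

/-! ## §2 The mirror order on the axis is the mixed kernel at negative times -/

/-- **The MIRROR order of the on-axis coupling is the mixed kernel at negative times**:
`latticeConnectedCorr r.ρ β (2L+1) Q Q^θ n = E_T[dens 0 ∘ Θ₀ · dens (−n e₀)] − E_T[dens 0] E_T[dens (−n e₀)]`
(reflection invariance of Wilson's torus measure, ✓`torusE_comp_cfgReflect`). [cite: OsterwalderSeiler1978, §2] -/
theorem lcc'_eq_mixedKernel_neg (r : LatticeRep G) (β : ℝ) (L n : ℕ) :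
    latticeConnectedCorr r.ρ β (2 * L + 1) r.curvature.F r.curvature.timeReflect.F n =
      torusE G r β L (fun V => dens G r 0 (cfgReflect V) * dens G r (-(Pi.single 0 (n : ℤ))) V) -
        torusE G r β L (dens G r 0) * torusE G r β L (dens G r (-(Pi.single 0 (n : ℤ)))) := by
  have hmean : torusE G r β L (dens G r (-(Pi.single 0 (n : ℤ)))) = torusE G r β L (dens G r 0) := by
    rw [torusE_dens_eq_wilsonTorusMean, torusE_dens_eq_wilsonTorusMean]
  rw [hmean]
  -- the reflected species translated by `n e₀` is `dens (−n e₀) ∘ Θ₀`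
  have hθ : siteReflect (-(Pi.single 0 (n : ℤ)) : Site 4) = Pi.single 0 (n : ℤ) := by
    funext k
    rw [siteReflect_apply_ite]
    by_cases hk : k = 0
    · subst hk; simp
    · simp [hk]
  have e1 : ∀ W : LGConfig 4 G,
      r.curvature.timeReflect.F (configShift (-Pi.single 0 (n : ℤ)) W) = dens G r (-(Pi.single 0 (n : ℤ))) (cfgReflect W) := by
    intro W
    rw [LocalGaugeObservable.timeReflect_F]
    unfold dens
    simp only []
    rw [cfgReflect_configShift, hθ, neg_neg]
  have e3 : ∀ W : LGConfig 4 G, r.curvature.F W = dens G r 0 W := fun W => (dens_zero_apply r W).symm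
  -- the mean of the reflected species
  have hB : ∫ U, r.curvature.timeReflect.F (torusLift (2 * L + 1) U) ∂(wilsonMeasure (d := 4) (L := 2 * L + 1) r.ρ β) =
      torusE G r β L (dens G r 0) := by
    have e0 : ∀ U : GaugeConfig 4 (2 * L + 1) G,
        r.curvature.timeReflect.F (torusLift (2 * L + 1) U) = dens G r 0 (cfgReflect (torusLift (2 * L + 1) U)) := by
      intro U; rw [LocalGaugeObservable.timeReflect_F, dens_zero_apply]
    simp_rw [e0]
    have h := torusE_comp_cfgReflect G r β L (dens G r 0)
    unfold torusE at h
    exact h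
  -- the pair integral, moved by the reflection `Θ₀`
  have hP : ∫ U, r.curvature.F (torusLift (2 * L + 1) U) *
        r.curvature.timeReflect.F (configShift (-Pi.single 0 (n : ℤ)) (torusLift (2 * L + 1) U))
        ∂(wilsonMeasure (d := 4) (L := 2 * L + 1) r.ρ β) =
      torusE G r β L (fun V => dens G r 0 (cfgReflect V) * dens G r (-(Pi.single 0 (n : ℤ))) V) := by
    simp_rw [e1, e3]
    have h := torusE_comp_cfgReflect G r β L (fun V => dens G r 0 (cfgReflect V) * dens G r (-(Pi.single 0 (n : ℤ))) V)
    simp only [cfgReflect_cfgReflect] at h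
    unfold torusE at h ⊢
    exact h
  unfold latticeConnectedCorr
  rw [hP, hB]
  have hA : ∫ U, r.curvature.F (torusLift (2 * L + 1) U) ∂(wilsonMeasure (d := 4) (L := 2 * L + 1) r.ρ β) =
      torusE G r β L (dens G r 0) := by
    simp_rw [e3]; unfold torusE; rfl
  rw [hA]

/-! ## §3 Translation invariance and symmetry of the plain covariance -/

/-- **`torusCov x y` depends on the separation `y − x` only.** [folklore] -/
theorem torusCov_translate (r : LatticeRep G) (β : ℝ) (L : ℕ) (x y : Site 4) :
    torusCov G r β L x y =
      torusE G r β L (fun V => dens G r 0 V * dens G r (y - x) V) - torusE G r β L (dens G r 0) * torusE G r β L (dens G r (y - x)) := by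
  unfold torusCov
  have hmeans : ∀ z : Site 4, torusE G r β L (dens G r z) = torusE G r β L (dens G r 0) := fun z => by
    rw [torusE_dens_eq_wilsonTorusMean, torusE_dens_eq_wilsonTorusMean]
  have h1 : (fun V => dens G r x V * dens G r y V) =
      fun V => dens G r (x - x) (configShift (-x) V) * dens G r (y - x) (configShift (-x) V) := by
    funext V; rw [dens_configShift_neg, dens_configShift_neg]
  rw [hmeans x, hmeans y, hmeans (y - x), h1,
    torusE_configShift_neg r β L (fun W => dens G r (x - x) W * dens G r (y - x) W) x, sub_self]

/-- **Symmetry** `torusCov x y = torusCov y x`. [folklore] -/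
theorem torusCov_comm (r : LatticeRep G) (β : ℝ) (L : ℕ) (x y : Site 4) :
    torusCov G r β L x y = torusCov G r β L y x := by
  unfold torusCov
  have h : (fun V => dens G r x V * dens G r y V) = fun V => dens G r y V * dens G r x V := by
    funext V; ring
  rw [h, mul_comm (torusE G r β L (dens G r x))]

/-- Two pairs with the same separation have the same covariance. [folklore] -/
theorem torusCov_eq_of_sub_eq (r : LatticeRep G) (β : ℝ) (L : ℕ) {x y x' y' : Site 4} (h : y - x = y' - x') :
    torusCov G r β L x y = torusCov G r β L x' y' := by
  rw [torusCov_translate, torusCov_translate r β L x' y', h]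

/-! ## §4 ★ Reflection-positivity domination of the plain covariance by both axis orders -/

/-- ★ **AXIS DOMINATION OF THE PLAIN COVARIANCE, both orders.**  On the odd torus `2L+1` at `β ≥ 0`, for heights `t, t'` with
`t + 2 ≤ L`, `2 ≤ t'`, `t' + 1 ≤ L` and two sites with time separation `y₀ − x₀ = t + t'`:
`torusCov(x,y)² ≤ lCC(Q,Q^θ,2t') · lCC(Q^θ,Q,2t)` with `0 ≤ lCC(Q,Q^θ,2t')` and `0 ≤ lCC(Q^θ,Q,2t)`.
Gram pair for ✓`OddTorusCovCauchySchwarz`: `F = dens(−t'e₀) ∘ Θ₀ ∘ lift` (the reflected species at height `t'`) and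
`H = dens(y − x − t'e₀) ∘ lift` (height `t`). [cite: OsterwalderSeiler1978, §2] [cite: FrohlichIsraelLiebSimon1978, Thm. 2.1] -/
theorem sq_torusCov_le_lcc_mul_lcc (r : LatticeRep G) {β : ℝ} (hβ : 0 ≤ β) (L t t' : ℕ) (ht : t + 2 ≤ L) (ht'2 : 2 ≤ t')
    (ht'L : t' + 1 ≤ L) (x y : Site 4) (hxy : y 0 - x 0 = (t : ℤ) + t') :
    0 ≤ latticeConnectedCorr r.ρ β (2 * L + 1) r.curvature.F r.curvature.timeReflect.F (2 * t') ∧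
    0 ≤ latticeConnectedCorr r.ρ β (2 * L + 1) r.curvature.timeReflect.F r.curvature.F (2 * t) ∧
    (torusCov G r β L x y) ^ 2 ≤
      latticeConnectedCorr r.ρ β (2 * L + 1) r.curvature.F r.curvature.timeReflect.F (2 * t') *
        latticeConnectedCorr r.ρ β (2 * L + 1) r.curvature.timeReflect.F r.curvature.F (2 * t) := by
  haveI := r.secondCountableTopology
  have hL : 1 ≤ L := by omega
  -- the Gram pair
  set u : Site 4 := -Pi.single 0 (t' : ℤ) with hu
  set v : Site 4 := (y - x) + u with hv
  have hu0 : u 0 = -(t' : ℤ) := by simp [hu]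
  have hv0 : v 0 = t := by simp [hv, hu, hxy]
  have hθu : siteReflect u = -u := by
    funext k
    rw [siteReflect_apply_ite]
    by_cases hk : k = 0
    · subst hk; simp
    · simp [hk, hu]
  have hsub : ∀ z : Site 4, z - siteReflect z = Pi.single 0 (2 * z 0) := by
    intro z
    funext k
    rw [Pi.sub_apply, siteReflect_apply_ite]
    by_cases hk : k = 0
    · subst hk; simp; ring
    · simp [hk]
  have huu : u - siteReflect u = -(Pi.single 0 ((2 * t' : ℕ) : ℤ)) := by
    rw [hsub, hu0]
    funext k
    by_cases hk : k = 0
    · subst hk; simp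
    · simp [hk]
  have hvv : v - siteReflect v = Pi.single 0 ((2 * t : ℕ) : ℤ) := by
    rw [hsub, hv0]; push_cast; ring_nf
  have hvu : v - u = y - x := by rw [hv]; abel
  obtain ⟨C, -, hC⟩ := exists_abs_dens_le G r
  set F : GaugeConfig 4 (2 * L + 1) G → ℝ := fun U => dens G r u (cfgReflect (torusLift (2 * L + 1) U)) with hF
  set H : GaugeConfig 4 (2 * L + 1) G → ℝ := fun U => dens G r v (torusLift (2 * L + 1) U) with hH
  have hFm : Measurable F :=
    ((continuous_dens r u).comp (continuous_cfgReflect.comp (continuous_torusLift _))).measurable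
  have hHm : Measurable H := ((continuous_dens r v).comp (continuous_torusLift _)).measurable
  have hFb : ∃ K : ℝ, ∀ U, |F U| ≤ K := ⟨C, fun U => hC _ _⟩
  have hHb : ∃ K : ℝ, ∀ U, |H U| ≤ K := ⟨C, fun U => hC _ _⟩
  have hFd := dependsOn_strictHalf_of_posHalf hL
    (dependsOn_dens_cfgReflect_posHalf r L u ⟨by rw [hu0]; omega, by rw [hu0]; omega⟩)
  have hHd := dependsOn_strictHalf_of_posHalf hL
    (dependsOn_dens_posHalf r L v ⟨by rw [hv0]; positivity, by rw [hv0]; omega⟩)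
  obtain ⟨h1, h2, h3⟩ := OddTorusCovCauchySchwarz G r.N r.ρ r.continuous β hβ L hL F H hFm hHm hFb hHb hFd hHd
  simp only [hF, hH, torusLift_negReflect, cfgReflect_cfgReflect] at h1 h2 h3
  -- dictionary between the lifted integrals and the `torusE` letters
  have i1 : (∫ U, dens G r u (torusLift (2 * L + 1) U) * dens G r u (cfgReflect (torusLift (2 * L + 1) U))
        ∂(wilsonMeasure (d := 4) (L := 2 * L + 1) r.ρ β)) =
      torusE G r β L (fun V => dens G r u (cfgReflect V) * dens G r u V) := by
    unfold torusE
    congr 1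
    funext U
    ring
  have i2 : (∫ U, dens G r u (cfgReflect (torusLift (2 * L + 1) U)) ∂(wilsonMeasure (d := 4) (L := 2 * L + 1) r.ρ β)) =
      torusE G r β L (dens G r u) := by
    have h := torusE_comp_cfgReflect G r β L (dens G r u)
    unfold torusE at h
    exact h
  have i3 : (∫ U, dens G r v (cfgReflect (torusLift (2 * L + 1) U)) * dens G r v (torusLift (2 * L + 1) U)
        ∂(wilsonMeasure (d := 4) (L := 2 * L + 1) r.ρ β)) =
      torusE G r β L (fun V => dens G r v (cfgReflect V) * dens G r v V) := rfl
  have i4 : (∫ U, dens G r v (torusLift (2 * L + 1) U) ∂(wilsonMeasure (d := 4) (L := 2 * L + 1) r.ρ β)) =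
      torusE G r β L (dens G r v) := rfl
  have i5 : (∫ U, dens G r u (torusLift (2 * L + 1) U) * dens G r v (torusLift (2 * L + 1) U)
        ∂(wilsonMeasure (d := 4) (L := 2 * L + 1) r.ρ β)) =
      torusE G r β L (fun V => dens G r u V * dens G r v V) := rfl
  rw [i1, i2] at h1
  rw [i3, i4] at h2
  rw [i5, i2, i4, i1, i3] at h3
  -- diagonal 1: the mirror order at height `2t'`; diagonal 2: the skeleton order at height `2t`; cross: the plain covariance
  have eFF : torusE G r β L (fun V => dens G r u (cfgReflect V) * dens G r u V) - torusE G r β L (dens G r u) * torusE G r β L (dens G r u) =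
      latticeConnectedCorr r.ρ β (2 * L + 1) r.curvature.F r.curvature.timeReflect.F (2 * t') := by
    rw [mixedCov_translate r β L u u, huu, ← lcc'_eq_mixedKernel_neg]
  have eHH : torusE G r β L (fun V => dens G r v (cfgReflect V) * dens G r v V) - torusE G r β L (dens G r v) * torusE G r β L (dens G r v) =
      latticeConnectedCorr r.ρ β (2 * L + 1) r.curvature.timeReflect.F r.curvature.F (2 * t) := by
    rw [mixedCov_translate r β L v v, hvv, ← lcc_eq_mixedKernel]
  have eFH : torusE G r β L (fun V => dens G r u V * dens G r v V) - torusE G r β L (dens G r u) * torusE G r β L (dens G r v) =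
      torusCov G r β L x y := by
    rw [torusCov_eq_of_sub_eq r β L (x := x) (y := y) (x' := u) (y' := v) hvu.symm]
    rfl
  rw [eFF] at h1 h3
  rw [eHH] at h2 h3
  rw [eFH] at h3
  exact ⟨h1, h2, h3⟩

/-! ## §5 ★ Pointwise bound under a symmetric axis window -/

/-- ★ **Plain covariance under a two-order axis bound.**  On the odd torus `2L+1` at `β ≥ 0`, for two sites with time separation
`|y₀ − x₀| = n`, `3 ≤ n`, `n/2 + 2 ≤ L`, and `B ≥ 0` bounding BOTH `(2⌊n/2⌋)⁸·lCC(Q^θ,Q,2⌊n/2⌋)` and `(2⌈n/2⌉)⁸·lCC(Q,Q^θ,2⌈n/2⌉)`: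
`|torusCov(x,y)| ≤ B/(n−1)⁸`. [cite: OsterwalderSeiler1978, §2] -/
theorem abs_torusCov_le_of_axis_bounds (r : LatticeRep G) {β : ℝ} (hβ : 0 ≤ β) (L n : ℕ) (hn3 : 3 ≤ n) (hnL : n / 2 + 2 ≤ L)
    (x y : Site 4) (hxy : y 0 - x 0 = (n : ℤ) ∨ x 0 - y 0 = (n : ℤ)) {B : ℝ} (hB0 : 0 ≤ B)
    (hG : ((2 * (n / 2) : ℕ) : ℝ) ^ 8 *
        latticeConnectedCorr r.ρ β (2 * L + 1) r.curvature.timeReflect.F r.curvature.F (2 * (n / 2)) ≤ B)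
    (hG' : ((2 * ((n + 1) / 2) : ℕ) : ℝ) ^ 8 *
        latticeConnectedCorr r.ρ β (2 * L + 1) r.curvature.F r.curvature.timeReflect.F (2 * ((n + 1) / 2)) ≤ B) :
    |torusCov G r β L x y| ≤ B / ((n : ℝ) - 1) ^ 8 := by
  -- reduce to `y₀ − x₀ = n` by symmetry
  wlog h : y 0 - x 0 = (n : ℤ) generalizing x y
  · have h' : x 0 - y 0 = (n : ℤ) := hxy.resolve_left h
    rw [torusCov_comm]
    exact this y x (Or.inl h') h'
  set t := n / 2 with ht_def
  set t' := (n + 1) / 2 with ht'_def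
  have htt' : (t : ℤ) + t' = n := by rw [ht_def, ht'_def]; omega
  obtain ⟨hpos1, hpos2, hsq⟩ := sq_torusCov_le_lcc_mul_lcc r hβ L t t' (by omega) (by omega) (by omega) x y
    (by rw [h, htt'])
  set A₁ := latticeConnectedCorr r.ρ β (2 * L + 1) r.curvature.F r.curvature.timeReflect.F (2 * t') with hA₁
  set A₂ := latticeConnectedCorr r.ρ β (2 * L + 1) r.curvature.timeReflect.F r.curvature.F (2 * t) with hA₂
  -- the two lattice times are `≥ n − 1 ≥ 2`
  have ht1 : (n : ℝ) - 1 ≤ ((2 * t' : ℕ) : ℝ) := by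
    have : n - 1 ≤ 2 * t' := by omega
    have h' : ((n - 1 : ℕ) : ℝ) ≤ ((2 * t' : ℕ) : ℝ) := by exact_mod_cast this
    rwa [Nat.cast_sub (by omega), Nat.cast_one] at h'
  have ht2 : (n : ℝ) - 1 ≤ ((2 * t : ℕ) : ℝ) := by
    have : n - 1 ≤ 2 * t := by omega
    have h' : ((n - 1 : ℕ) : ℝ) ≤ ((2 * t : ℕ) : ℝ) := by exact_mod_cast this
    rwa [Nat.cast_sub (by omega), Nat.cast_one] at h'
  have hm0 : 0 < (n : ℝ) - 1 := by
    have : (3 : ℝ) ≤ n := by exact_mod_cast hn3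
    linarith
  set M : ℝ := ((n : ℝ) - 1) ^ 8 with hM
  have hM0 : 0 < M := by positivity
  have hA₁le : A₁ ≤ B / M := by
    have hp : 0 < ((2 * t' : ℕ) : ℝ) ^ 8 := pow_pos (hm0.trans_le ht1) 8
    have h' : A₁ ≤ B / ((2 * t' : ℕ) : ℝ) ^ 8 := by
      rw [le_div_iff₀ hp, mul_comm]; exact hG'
    refine h'.trans (div_le_div_of_nonneg_left hB0 hM0 ?_)
    exact pow_le_pow_left₀ hm0.le ht1 8
  have hA₂le : A₂ ≤ B / M := by
    have hp : 0 < ((2 * t : ℕ) : ℝ) ^ 8 := pow_pos (hm0.trans_le ht2) 8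
    have h' : A₂ ≤ B / ((2 * t : ℕ) : ℝ) ^ 8 := by
      rw [le_div_iff₀ hp, mul_comm]; exact hG
    refine h'.trans (div_le_div_of_nonneg_left hB0 hM0 ?_)
    exact pow_le_pow_left₀ hm0.le ht2 8
  have hprod : A₁ * A₂ ≤ (B / M) ^ 2 := by
    rw [sq]
    exact mul_le_mul hA₁le hA₂le hpos2 (div_nonneg hB0 hM0.le)
  exact abs_le_of_sq_le_sq (hsq.trans hprod) (div_nonneg hB0 hM0.le)

end Summit.QuantumFields.YangMills.Theorems.ForcedResponseSkewnessRunningCouplingCeilingCovAxisDomination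

end
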